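import Literature.AlgebraicGeometry.Motives.PoincareUniversal.ModelTowerInstance
import Literature.AlgebraicGeometry.Motives.PoincareUniversal.ArtinianLevelFrames
import Literature.AlgebraicGeometry.Motives.PoincareUniversal.LevelZeroGraphPoint
import Literature.AlgebraicGeometry.Motives.PoincareUniversal.LevelZero
import Literature.AlgebraicGeometry.Motives.PoincareUniversal.LevelTangentDimension
import Literature.AlgebraicGeometry.Motives.PoincareUniversal.KodairaSpencerInjective
import Literature.AlgebraicGeometry.Motives.PoincareUniversal.PoincareFirstOrderRigid
import Literature.AlgebraicGeometry.Modules.FiniteAffineTrivialisingCover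
import Literature.AlgebraicGeometry.HodgeTheory.AbelianVarietyCechH1StructureSheafBound
import HarnessLib

/-!
# M13 node N3: `stub_M13_3_exists_thickening_lift` — every thickening `Spec 𝒪_{T,t}/𝔪^{n+1}` of a closed point carries a
# `T × Â`-valued point with the graph condition

Cell hodgecm-mathlib, M13 phase B, node N3 HEAD (lead B-p20 (g7); this file B-p07 (g12), R130).  The SPEC statement
(`M13-signatures.probe` :245) token for token, with NO socket left: the level-indexed lift model of
`PoincareUniversal/ModelTowerInstance` (levels `𝒪_{T,t}/𝔪^{n+1}`, Artinian charts `𝒪_{Â,y₀}/𝔪^{n+1}` at the point `y₀` with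
`𝒫|_{A₀ × y₀} ≅ ℒ|_{A₀ × t}` (γ6 `LevelZeroGraphPoint`), frames by nilpotent Nakayama (γ4 `ArtinianLevelFrames`), lifts by
smoothness of `Â` (γ7), tangent dimension `g` (γ9 `LevelTangentDimension`)), the per-level INJECTIVITY of its Kodaira–Spencer
maps (γ8 `KodairaSpencerInjective` ∘ first-order rigidity of `𝒫`, `PoincareFirstOrderRigid` — the N3d input), and the bound
`h¹(A₀, 𝒪) ≤ g` on the finite affine cover ((3e) `HodgeTheory/AbelianVarietyCechH1StructureSheafBound`) feed the abstract
induction `LiftModel₂.exists_graph` (`Morphisms/CechUnitCocycleLiftInduction`); the graph of the resulting chart point is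
read back as the graph condition (γ10 `graphCond_of_iso`).  [MumfordAV1970] §13, proof of the Theorem, pp. 125–130.
HC_CM is proved only modulo the 7 printed citations until rung 0 closes.

## References
* [MumfordAV1970] D. Mumford, *Abelian Varieties* (1970), §13 (proof of the Thm. pp. 125–130).
* [GortzWedhorn2023] U. Görtz, T. Wedhorn, *Algebraic Geometry II* (2023), Lemma 26.15, Prop. 27.122.
-/

noncomputable section

universe u v

open TensorProduct CategoryTheory AlgebraicGeometry

namespace Literature.AlgebraicGeometry.Motives.AbelianVariety

open CategoryTheory CategoryTheory.Limits AlgebraicGeometry MonoidalCategory CartesianMonoidalCategory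
open Literature.AlgebraicGeometry.AbelianSchemes Literature.AlgebraicGeometry.AbelianVarieties
  Literature.AlgebraicGeometry.Modules Literature.AlgebraicGeometry.Morphisms
  Literature.AlgebraicGeometry.Morphisms.CechUnitCocycle Literature.AlgebraicGeometry.Motives

section N3Head


variable (A₀ : AbelianVariety ℂ) {Θ : CartierDivisor A₀.X.left} (hΘ : Θ.IsAmple)
  (P : (A₀.X ⊗ (A₀.dualOf Θ hΘ).X).left.Modules)
  (T' : SchemeOver ℂ) (ℒ : (AbelianSchemeOver.ofAbelianVariety A₀).RigidifiedLineBundle T'.hom)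

/-- **N3 — `stub_M13_3_exists_thickening_lift` (M13 SPEC :245, signature verbatim; ZERO sockets)**: for a rank-one `𝒫` on
`A₀ × Â` with `(1 × φ_Θ)^*𝒫 ≅ Λ(𝒪(Θ))`, normalised along `A₀ × 0`, a rigidified `ℒ` on `A₀ × T` with fibrewise `Pic⁰`
classes, a closed point `t ∈ T` (`T` affine of finite type) and every `n`, there is a morphism
`g : Spec 𝒪_{T,t}/𝔪^{n+1} → Â` such that the pair `(ι_n, g)` satisfies the graph condition
`(1 × g)^*𝒫 ≅ (1 × ι_n)^*ℒ` on `A₀ × Spec 𝒪_{T,t}/𝔪^{n+1}`. [cite: MumfordAV1970, §13 (proof of the Thm. pp. 125–130)]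
[cite: GortzWedhorn2023, Prop. 27.122] -/
theorem stub_M13_3_exists_thickening_lift [IsAffine T'.left] [LocallyOfFiniteType T'.hom] [P.IsQuasicoherent]
    (hP1 : HasRank P 1)
    (eP : Nonempty ((Scheme.Modules.pullback (AbelianVariety.Hom.toSchemeHom (A₀.oneProdPhiTheta hΘ))).obj P ≅
      mumfordSheaf A₀ Θ))
    (_hnorm : Nonempty ((Scheme.Modules.pullback (sliceZero A₀ (A₀.dualOf Θ hΘ)).left).obj P ≅
      unitModule (A₀.dualOf Θ hΘ).X.left))
    (hℒ : ℒ.FibrewisePicZero) (t : T'.left) (ht : IsClosed ({t} : Set T'.left)) (n : ℕ) :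
    ∃ g : thickeningPt T' t n ⟶ (A₀.dualOf Θ hΘ).X,
      GraphCond A₀ hΘ P T' ℒ (CartesianMonoidalCategory.lift (thickeningPtι T' t n) g) := by
  classical
  haveI : IsLocallyNoetherian T'.left := LocallyOfFiniteType.isLocallyNoetherian T'.hom
  haveI : LocallyOfFiniteType (A₀.dualOf Θ hΘ).X.hom := (A₀.dualOf Θ hΘ).isProper.toLocallyOfFiniteType
  haveI : IsLocallyNoetherian (A₀.dualOf Θ hΘ).X.left :=
    LocallyOfFiniteType.isLocallyNoetherian (A₀.dualOf Θ hΘ).X.hom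
  haveI : IsSeparated A₀.X.hom := A₀.isProper.toIsSeparated
  -- the `ℂ`-point `x` of `T` at `t` (the level-zero thickening is `Spec ℂ`)
  let x : AlgPoints T' ℂ := (levelZeroIso T' t ht).inv ≫ thickeningPtι T' t 0
  have hx : thickeningPtι T' t 0 = toSpecOver (thickeningPt T' t 0) ≫ x := by
    rw [← levelZeroIso_hom T' t ht, Iso.hom_inv_id_assoc]
  -- the point `b` of `Â` with `𝒫|_{A₀ × b} ≅ ℒ|_{A₀ × x}` (Mumford §8 Thm. 1, via the universal property of `𝒫`)
  obtain ⟨b, ⟨ψ⟩⟩ := exists_point_sliceIso A₀ hΘ P T' ℒ hP1 eP hℒ x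
  have hy₀ : IsClosed ({AlgPoints.pt b} : Set (A₀.dualOf Θ hΘ).X.left) := AlgPoints.isClosed_singleton_pt b
  have hb : b.left (IsLocalRing.closedPoint ℂ) = AlgPoints.pt b := rfl
  have huniq := algHom_levelZero_eq (A₀.dualOf Θ hΘ).X (AlgPoints.pt b) hy₀
  have hbij := ρℂ_zero_bijective (A₀.dualOf Θ hΘ).X (AlgPoints.pt b) hy₀
  -- a finite affine cover of `A₀` trivialising `ℒ|_{A₀ × x}`
  obtain ⟨ι, hfin, V, hV, hcov, hfr⟩ := exists_finite_affine_trivialising_cover A₀.X.left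
    ((Scheme.Modules.pullback (sliceMor A₀ x).left).obj ℒ.L) (hasRank_pullback _ ℒ.hasRank_one)
  haveI := hfin
  let FM : IFrames ((Scheme.Modules.pullback (sliceMor A₀ x).left).obj ℒ.L) V := ⟨fun a => (hfr a).some⟩
  -- the inputs of the model tower: frames by Nakayama (γ4) from the level-0 frames (γ6), base (γ6), lift (γ7)
  let G : GammaInputs A₀ hΘ P T' ℒ t ht V (AlgPoints.pt b) hy₀ :=
    ⟨framesL A₀ T' ℒ t V hV (framesL0 A₀ T' ℒ t V x hx FM),
     framesP A₀ hΘ P (AlgPoints.pt b) V hV hP1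
       (framesP0 A₀ hΘ P (AlgPoints.pt b) hy₀ V b hb huniq hbij (FM.mapIso ψ.symm)),
     base_of_sliceIso A₀ hΘ P T' ℒ t ht (AlgPoints.pt b) hy₀ b hb x hx ψ huniq,
     fun n φ _ => exists_lift_chartPoint A₀ hΘ T' t (AlgPoints.pt b) n φ⟩
  let 𝕋 := modelTower A₀ hΘ P T' ℒ t ht V hV (AlgPoints.pt b) hy₀ hcov G
  -- (γ8) per-level injectivity of the Kodaira–Spencer maps, from the first-order rigidity of `𝒫`
  have hKS : ∀ m, Function.Injective (ksLinear (𝕋.liftModel.p (m + 1)) (𝕋.liftModel.ev (m + 1))) := fun m =>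
    ksLinear_injective_of_rigid A₀ hΘ P V hV (AlgPoints.pt b) hy₀ hcov hP1 (poincare_firstOrderRigid A₀ hΘ P eP) m
      (G.FP (m + 1))
  -- (γ9) the tangent spaces of the levels have dimension `g`
  have hdim : ∀ m, FiniteDimensional ℂ (DerAt (𝕋.liftModel.ev (m + 1))) ∧
      Module.finrank ℂ (DerAt (𝕋.liftModel.ev (m + 1))) = A₀.dim := fun m => by
    have h := finrank_derAt_ρℂ (A₀.dualOf Θ hΘ) (AlgPoints.pt b) hy₀ m
    rw [AbelianVariety.dim_dualOf] at h
    exact h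
  -- (3e) `h¹(A₀, 𝒪) ≤ g` on the finite affine cover
  obtain ⟨hfinH, hle⟩ :=
    Literature.AlgebraicGeometry.HodgeTheory.AbelianVariety.socket_N3e_cechH1_finrank_le_holds A₀ ι hfin V hV hcov
  haveI := hfinH
  haveI : ∀ m, FiniteDimensional ℂ (DerAt (𝕋.liftModel.ev (m + 1))) := fun m => (hdim m).1
  -- the abstract induction and the graph condition of the resulting chart point (γ10)
  obtain ⟨φ, hφ⟩ := 𝕋.liftModel.exists_graph hKS (fun m => by rw [(hdim m).2]; exact hle) n
  exact ⟨ptn A₀ hΘ T' t (AlgPoints.pt b) n n φ,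
    graphCond_of_iso A₀ hΘ P T' ℒ t (AlgPoints.pt b) n n φ (Classical.choice hφ.1)⟩

end N3Head

end Literature.AlgebraicGeometry.Motives.AbelianVariety

end
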